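import Literature.Probability.RandomPlanarGeometry.SLEKappaRhoRegular
import Literature.Probability.RandomPlanarGeometry.LoewnerAdaptedPlane
import Literature.Probability.RandomPlanarGeometry.LoewnerCotArgExit
import Literature.Probability.RandomPlanarGeometry.LoewnerPointFlow
import Literature.Analysis.FunctionSpaces.BesselBoundaryZeroSetProofs
import HarnessLib

/-!
# SLE(κ, ρ): good sample paths of a regular version, and the adapted complex point flow of an a.s.-continuous driver

Measure-theoretic set-up for the almost-sure form of Miller–Sheffield's Theorem 2.4 (⇒)
(J. Miller, S. Sheffield, *Imaginary geometry I*, PTRF 164 (2016), §2.3;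
`ImaginaryGeometryHarmonicProofs.lean`). The SLE(κ, ρ) driving pair `(O, W)` of the tree
(`IsSLEKappaRhoPair`, [LSW] §8.3) is built pathwise from a Bessel process with only a.s.-continuous
paths, so neither `O` nor `W` is known to be adapted; the stochastic calculus is therefore run on a
REGULAR VERSION `(W', J)` (`SLEKappaRho.RegularPair`, `SLEKappaRhoRegular.lean`). This file adds:

* `SLEKappaRho.GoodPath κ ρ O W W' J ω` — the conjunction of the almost-sure clauses along ONE
  sample path: `W' = W`, `W'` continuous, `J` locally integrable, `W'_t = √κ B_t + ρ ∫₀ᵗ J`,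
  **`O_t = -2 ∫₀ᵗ J`** (the force point is the time integral too) and **`Z'_s := W'_s + 2∫₀ˢ J > 0`
  for a.e. `s > 0`** (the collision times of `W` with its force point — the zero set of the Bessel
  process — are Lebesgue-null, `IsBesselProcess.ae_pos_of_ae_restrict_Ioi_holds`, Revuz–Yor XI
  Prop. (1.5), dimension `d = 1 + 2(ρ+2)/κ > 1`); `IsSLEKappaRhoPair.exists_regularPair_goodPath`:
  every SLE(κ, ρ) pair (`κ > 0`, `ρ > -2`) has a regular version almost all of whose paths are good;
* `Loewner.cmapProc V z`, `Loewner.imProc V z` — the centred complex flow `z_t = g_t(z) - V_t` and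
  its frozen imaginary part, of a PROCESS `V` (time first) read through the regularised driving
  path up to time `t` (`Loewner.drivingUpTo`, `SLEKappaRhoFlow.lean`): adapted to any filtration to
  which `V` is adapted (`Loewner.measurable_map_of_im_pos`, `LoewnerAdaptedPlane.lean`), and equal
  to the honest flow of the path `s ↦ V s ω` at EVERY time on every continuous path (locality of
  the Loewner flow in the driving function, `Loewner.map_eq_of_eqOn`);
* `Loewner.xReg`, `Loewner.yReg`, `SLEKappaRho.zReg` — progressively measurable versions
  (`dyadicReg`) of `re z_t`, `y_t` and `Z'_t`, equal to the honest quantities on good paths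
  (before `T_z` for `x`, which is continuous there).

No named fact is introduced.

## References

* J. Miller, S. Sheffield, *Imaginary geometry I*, PTRF 164 (2016), §2 (Def. 2.1: the processes
  are adapted to the filtration of `B`; Thm. 2.4).
* G. F. Lawler, O. Schramm, W. Werner, *Conformal restriction: the chordal case*, JAMS 16 (2003),
  §8.3 (`W = √κ B + ρ ∫ du/Z_u`, `O = -2 ∫ du/Z_u`).
* D. Revuz, M. Yor, *Continuous Martingales and Brownian Motion* (1999), Ch. XI Prop. (1.5);
  Ch. I Prop. (4.8) (progressive versions).
-/

noncomputable section

open Set Filter MeasureTheory Complex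
open _root_.Topology
open scoped NNReal
open Literature.Analysis.FunctionSpaces Literature.Probability.Process

namespace Literature.Probability.RandomPlanarGeometry

/-! ### Good sample paths of a regular version -/

/-- **Good sample path** of an SLE(κ, ρ) driving pair `(O, W)` with regular version `(W', J)`:
along the sample `ω`, `W' = W` at all times, the path of `W'` is continuous, `J` is integrable on
every `[0, t]`, `W'_t = √κ B_t + ρ ∫₀ᵗ J_s ds` and `O_t = -2 ∫₀ᵗ J_s ds` for all `t` ([LSW] §8.3:
`W_t = √κ B_t + ρ ∫₀ᵗ du/Z_u`, `O_t = -2 ∫₀ᵗ du/Z_u`), and `Z'_s = W'_s + 2 ∫₀ˢ J > 0` for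
Lebesgue-a.e. `s > 0` (the zero set of the Bessel process `Z/√κ` is null, Revuz–Yor XI (1.5)).
Almost every path is good (`IsSLEKappaRhoPair.exists_regularPair_goodPath`).
[cite: LawlerSchrammWerner2003Restriction, §8.3 (definition of SLE(κ, ρ), p. 36)] -/
structure SLEKappaRho.GoodPath (κ : ℝ≥0) (ρ : ℝ) (O W W' J : ℝ≥0 → (ℝ≥0 → ℝ) → ℝ)
    (ω : ℝ≥0 → ℝ) : Prop where
  /-- `W' = W` along the path. -/
  eq : ∀ t, W' t ω = W t ω
  /-- The path of `W'` is continuous. -/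
  continuous : Continuous fun t ↦ W' t ω
  /-- `J` is integrable on every `[0, t]`. -/
  intervalIntegrable : ∀ t : ℝ≥0, IntervalIntegrable (fun s : ℝ ↦ J s.toNNReal ω) volume 0 t
  /-- `W'_t = √κ B_t + ρ ∫₀ᵗ J`. -/
  eq_brownian : ∀ t, W' t ω = Real.sqrt κ * brownian t ω + ρ * timeIntegral J t ω
  /-- `O_t = -2 ∫₀ᵗ J`. -/
  fst_eq : ∀ t, O t ω = -2 * timeIntegral J t ω
  /-- `Z'_s = W'_s + 2 ∫₀ˢ J > 0` for a.e. `s > 0`. -/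
  ae_pos : ∀ᵐ s ∂(volume.restrict (Ioi (0 : ℝ))), 0 < W' s.toNNReal ω + 2 * timeIntegral J s.toNNReal ω

/-- The Bessel dimension of SLE(κ, ρ) exceeds `1` iff `ρ > -2` (`κ > 0`). [cite: LawlerSchrammWerner2003Restriction, §8.3 (p. 36)] -/
theorem one_lt_sleKappaRhoDim {κ : ℝ≥0} {ρ : ℝ} (hκ : 0 < κ) (hρ : -2 < ρ) :
    1 < sleKappaRhoDim κ ρ := by
  have hκ' : (0 : ℝ) < κ := by exact_mod_cast hκ
  rw [sleKappaRhoDim]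
  have : 0 < 2 * (ρ + 2) / (κ : ℝ) := div_pos (by linarith) hκ'
  linarith

/-- **Every SLE(κ, ρ) driving pair (`κ > 0`, `ρ > -2`) has a regular version almost all of whose
paths are good.** Same construction as `IsSLEKappaRhoPair.exists_regularPair` (`Z' = √κ √(dyadicReg Z)`,
`J = 1/Z'`, `W' = Z' - 2 ∫₀ J` for the squared Bessel process `Z` behind the pair), recording in
addition, on the a.s. event `dyadicReg Z = Z`, that `O = -2 ∫₀ J` (definition of `O`) and that
`Z' = √κ X > 0` at a.e. positive time (`IsBesselProcess.ae_pos_of_ae_restrict_Ioi_holds`, as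
`d = 1 + 2(ρ+2)/κ > 1`). [cite: LawlerSchrammWerner2003Restriction, §8.3 (definition of SLE(κ, ρ), p. 36)] -/
theorem IsSLEKappaRhoPair.exists_regularPair_goodPath {κ : ℝ≥0} {ρ : ℝ}
    {O W : ℝ≥0 → (ℝ≥0 → ℝ) → ℝ} (hκ : 0 < κ) (hρ : -2 < ρ) (hOW : IsSLEKappaRhoPair κ ρ O W) :
    ∃ W' J, SLEKappaRho.RegularPair κ ρ W W' J ∧
      ∀ᵐ ω ∂preWienerMeasure, SLEKappaRho.GoodPath κ ρ O W W' J ω := by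
  obtain ⟨X, hXb, hO, hW⟩ := id hOW
  obtain ⟨Z, hZ, hXZ⟩ := id hXb
  obtain ⟨-, hprog, hae⟩ := IsStrongSolution.dyadicReg_spec hZ
  set Zr := dyadicReg Z with hZr
  set J : ℝ≥0 → (ℝ≥0 → ℝ) → ℝ := fun s ω ↦ (Real.sqrt κ * Real.sqrt (Zr s ω))⁻¹ with hJ
  set W' : ℝ≥0 → (ℝ≥0 → ℝ) → ℝ :=
    fun t ω ↦ Real.sqrt κ * Real.sqrt (Zr t ω) + (-2) * timeIntegral J t ω with hW'
  have hJprog : IsStronglyProgressive brownianFiltration J := by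
    have hF : Measurable (Function.uncurry fun (_ : ℝ) (v : ℝ) ↦ (Real.sqrt κ * Real.sqrt v)⁻¹) :=
      (measurable_const.mul measurable_snd.sqrt).inv
    exact IsStronglyProgressive.comp_measurable₂ hprog (F := fun _ v ↦ (Real.sqrt κ * Real.sqrt v)⁻¹) hF
  have hZad : Adapted brownianFiltration Zr := adapted_dyadicReg hZ.adapted
  -- on the a.s. event `Zr = Z`: the integrand and the driving function are those of the pair
  have hJeq : ∀ ω, (∀ t, Zr t ω = Z t ω) → ∀ u : ℝ,
      J u.toNNReal ω = (W u.toNNReal ω - O u.toNNReal ω)⁻¹ := by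
    intro ω hω u
    simp only [hJ, hω, hW u.toNNReal ω, hXZ u.toNNReal ω, add_sub_cancel_right]
  have hJeqX : ∀ ω, (∀ t, Zr t ω = Z t ω) → ∀ u : ℝ,
      J u.toNNReal ω = (Real.sqrt κ * X u.toNNReal ω)⁻¹ := by
    intro ω hω u
    simp only [hJ, hω, hXZ u.toNNReal ω]
  have hIeq : ∀ ω, (∀ t, Zr t ω = Z t ω) → ∀ t : ℝ≥0,
      timeIntegral J t ω = ∫ u in (0 : ℝ)..(t : ℝ), (Real.sqrt κ * X u.toNNReal ω)⁻¹ := by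
    intro ω hω t
    simp only [timeIntegral]
    exact intervalIntegral.integral_congr fun u _ ↦ hJeqX ω hω u
  have hW'eq : ∀ ω, (∀ t, Zr t ω = Z t ω) → ∀ t, W' t ω = W t ω := by
    intro ω hω t
    rw [hW t ω, hXZ t ω, hO t ω]
    simp only [hW', hω, hIeq ω hω t]
  have hOeq : ∀ ω, (∀ t, Zr t ω = Z t ω) → ∀ t, O t ω = -2 * timeIntegral J t ω := by
    intro ω hω t
    rw [hO t ω, hIeq ω hω t]
  have hZ'eq : ∀ ω, (∀ t, Zr t ω = Z t ω) → ∀ t,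
      W' t ω + 2 * timeIntegral J t ω = Real.sqrt κ * X t ω := by
    intro ω hω t
    simp only [hW', hω, hXZ t ω]
    ring
  have hpair : SLEKappaRho.RegularPair κ ρ W W' J := by
    refine ⟨?_, ?_, hJprog, ?_, ?_, ?_, ?_, ?_, ?_⟩
    · -- adapted
      intro t
      exact (((hZad t).sqrt).const_mul _).add ((adapted_timeIntegral hJprog t).const_mul _)
    · -- `W'_0 = 0`
      intro ω
      have h0 : Zr 0 ω = 0 := by
        rw [hZr, dyadicReg_apply_zero, IsStrongSolution.apply_zero hZ]
        simp
      simp [hW', h0, timeIntegral_apply_zero]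
    · -- `J ≥ 0`
      intro t ω
      exact inv_nonneg.2 (mul_nonneg (Real.sqrt_nonneg _) (Real.sqrt_nonneg _))
    · -- `J = 1/Z'`
      intro t ω
      simp only [hW', hJ]
      ring_nf
    · -- a.s. `W' = W`
      filter_upwards [hae] with ω hω t using hW'eq ω hω t
    · -- a.s. continuity
      filter_upwards [hae, hOW.ae_continuous SLEKappaRho.integral_inv_eq_holds hκ hρ] with ω hω hc
      have : (fun t ↦ W' t ω) = fun t ↦ W t ω := funext (hW'eq ω hω)
      rw [this]
      exact hc.1
    · -- a.s. integrability of `J`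
      filter_upwards [hae, SLEKappaRho.integral_inv_eq_holds hκ hρ hOW] with ω hω hint t
      have : (fun s : ℝ ↦ J s.toNNReal ω) = fun s ↦ (W s.toNNReal ω - O s.toNNReal ω)⁻¹ :=
        funext (hJeq ω hω)
      rw [this]
      exact (hint t).1
    · -- a.s. `W' = √κ B + ρ ∫ J`
      filter_upwards [hae, SLEKappaRho.ae_snd_eq_of SLEKappaRho.integral_inv_eq_holds hκ hρ hOW]
        with ω hω hB t
      have hI : timeIntegral J t ω = ∫ u in (0 : ℝ)..(t : ℝ), (W u.toNNReal ω - O u.toNNReal ω)⁻¹ := by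
        simp only [timeIntegral]
        exact intervalIntegral.integral_congr fun u _ ↦ hJeq ω hω u
      rw [hW'eq ω hω t, hI]
      exact hB t
  refine ⟨W', J, hpair, ?_⟩
  -- the zero set of the Bessel process is null
  have hpos := IsBesselProcess.ae_pos_of_ae_restrict_Ioi_holds (one_lt_sleKappaRhoDim hκ hρ) le_rfl hXb
  have hsκ : 0 < Real.sqrt κ := Real.sqrt_pos.2 (by exact_mod_cast hκ)
  filter_upwards [hae, hpair.ae_continuous, hpair.ae_intervalIntegrable, hpair.ae_eq_brownian, hpos]
    with ω hω hc hint hB hposω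
  refine ⟨hW'eq ω hω, hc, hint, hB, hOeq ω hω, ?_⟩
  filter_upwards [hposω] with s hs
  rw [hZ'eq ω hω]
  exact mul_pos hsκ hs

namespace SLEKappaRho.GoodPath

variable {κ : ℝ≥0} {ρ : ℝ} {O W W' J : ℝ≥0 → (ℝ≥0 → ℝ) → ℝ} {ω : ℝ≥0 → ℝ}

/-- On a good path the paths of `W'` and `W` coincide as functions. [folklore] -/
theorem path_eq (h : GoodPath κ ρ O W W' J ω) : (fun t ↦ W' t ω) = fun t ↦ W t ω :=
  funext h.eq

/-- On a good path the path of `W` is continuous. [folklore] -/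
theorem continuous_snd (h : GoodPath κ ρ O W W' J ω) : Continuous fun t ↦ W t ω := by
  rw [← h.path_eq]; exact h.continuous

/-- On a good path `J` is integrable on every `[0, t]` (`IntegrableOn` form). [folklore] -/
theorem integrableOn (h : GoodPath κ ρ O W W' J ω) (t : ℝ≥0) :
    IntegrableOn (fun s : ℝ ↦ J s.toNNReal ω) (Icc 0 t) :=
  (intervalIntegrable_iff_integrableOn_Icc_of_le t.coe_nonneg).1 (h.intervalIntegrable t)

/-- On a good path the time integral `t ↦ ∫₀ᵗ J` is continuous. [folklore] -/
theorem continuous_timeIntegral (h : GoodPath κ ρ O W W' J ω) :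
    Continuous fun t ↦ timeIntegral J t ω :=
  Literature.Analysis.FunctionSpaces.continuous_timeIntegral h.integrableOn

/-- On a good path `Z' = W' + 2 ∫₀ J` has a continuous path. [folklore] -/
theorem continuous_zPrime (h : GoodPath κ ρ O W W' J ω) :
    Continuous fun t ↦ W' t ω + 2 * timeIntegral J t ω :=
  h.continuous.add (continuous_const.mul h.continuous_timeIntegral)

/-- On a good path `Z'_t = W'_t + 2 ∫₀ᵗ J = √κ B_t + (ρ + 2) ∫₀ᵗ J`. [cite: LawlerSchrammWerner2003Restriction, §8.3 (p. 36)] -/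
theorem zPrime_eq_brownian (h : GoodPath κ ρ O W W' J ω) (t : ℝ≥0) :
    W' t ω + 2 * timeIntegral J t ω = Real.sqrt κ * brownian t ω + (ρ + 2) * timeIntegral J t ω := by
  rw [h.eq_brownian t]; ring

/-- On a good path `W_t - O_t = Z'_t`. [cite: LawlerSchrammWerner2003Restriction, §8.3 (p. 36)] -/
theorem snd_sub_fst (h : GoodPath κ ρ O W W' J ω) (t : ℝ≥0) :
    W t ω - O t ω = W' t ω + 2 * timeIntegral J t ω := by
  rw [← h.eq t, h.fst_eq t]; ring

end SLEKappaRho.GoodPath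

/-! ### The complex point flow of a driving process -/

namespace Loewner

section Proc

variable {Ω : Type*} {mΩ : MeasurableSpace Ω}

variable (V : ℝ≥0 → Ω → ℝ) (z : ℂ)

/-- **The centred complex flow of a driving process** `V` (time first) at the point `z`:
`cmapProc V z t ω = centredMap (drivingUpTo V t ω) t z`, the centred Loewner map
`g_t(z) - V_t` of the regularised driving path up to time `t`. On continuous paths it is the honest
centred flow of `s ↦ V s ω` (`cmapProc_eq_of_continuous`), and it is adapted. [folklore] -/
def cmapProc (t : ℝ≥0) (ω : Ω) : ℂ :=
  centredMap (drivingUpTo V t ω) t z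

/-- **The frozen imaginary part of the flow of a driving process**:
`imProc V z t ω = imFlowStop (drivingUpTo V t ω) z t`. [folklore] -/
def imProc (t : ℝ≥0) (ω : Ω) : ℝ :=
  imFlowStop (drivingUpTo V t ω) z t

variable {V z}

/-- On a continuous driving path the regularised path up to time `t` agrees with the path on
`[0, t]`. [folklore] -/
theorem drivingUpTo_eqOn_of_continuous {ω : Ω} (hc : Continuous fun s ↦ V s ω) (t : ℝ≥0) :
    ∀ s, s ≤ t → (fun s ↦ V s ω) s = drivingUpTo V t ω s := by
  intro s hs
  rw [drivingUpTo_eq_of_continuous hc t]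
  simp [min_eq_left hs]

/-- **On a continuous path the flow process is the honest centred flow of the path**, at every
time: before `T_z` by locality of the Loewner map in the driving function (`map_eq_of_eqOn`),
and from `T_z` on because both take the junk value `z - V_t` (the swallowing relation `t < T_z` is
itself local, `coe_lt_swallowingTime_of_eqOn`). [cite: Lawler2005, Ch. 4 §4.1] -/
theorem cmapProc_eq_of_continuous {ω : Ω} (hc : Continuous fun s ↦ V s ω) (t : ℝ≥0) :
    cmapProc V z t ω = centredMap (fun s ↦ V s ω) t z := by
  have hU : Continuous (drivingUpTo V t ω) := continuous_drivingUpTo V t ω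
  have heq := drivingUpTo_eqOn_of_continuous hc t
  have hUt : drivingUpTo V t ω t = V t ω := by rw [← heq t le_rfl]
  unfold cmapProc
  rw [centredMap_apply, centredMap_apply, hUt]
  by_cases ht : (t : WithTop ℝ≥0) < swallowingTime (fun s ↦ V s ω) z
  · rw [map_eq_of_eqOn hc hU heq ht le_rfl]
  · have ht' : ¬ (t : WithTop ℝ≥0) < swallowingTime (drivingUpTo V t ω) z := fun h ↦
      ht (coe_lt_swallowingTime_of_eqOn hU hc (fun s hs ↦ (heq s hs).symm) h)
    rw [map_of_not_lt_swallowingTime ht, map_of_not_lt_swallowingTime ht']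

/-- **On a continuous path the frozen-imaginary-part process is the honest one** at every time.
[cite: Lawler2005, Ch. 4 §4.1] -/
theorem imProc_eq_of_continuous {ω : Ω} (hc : Continuous fun s ↦ V s ω) (t : ℝ≥0) :
    imProc V z t ω = imFlowStop (fun s ↦ V s ω) z t := by
  have hU : Continuous (drivingUpTo V t ω) := continuous_drivingUpTo V t ω
  have heq := drivingUpTo_eqOn_of_continuous hc t
  unfold imProc
  by_cases ht : (t : WithTop ℝ≥0) < swallowingTime (fun s ↦ V s ω) z
  · have ht' : (t : WithTop ℝ≥0) < swallowingTime (drivingUpTo V t ω) z :=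
      coe_lt_swallowingTime_of_eqOn hc hU heq ht
    rw [imFlowStop_of_lt ht, imFlowStop_of_lt ht', map_eq_of_eqOn hc hU heq ht le_rfl]
  · have ht' : ¬ (t : WithTop ℝ≥0) < swallowingTime (drivingUpTo V t ω) z := fun h ↦
      ht (coe_lt_swallowingTime_of_eqOn hU hc (fun s hs ↦ (heq s hs).symm) h)
    rw [imFlowStop_of_not_lt ht, imFlowStop_of_not_lt ht']

/-- **The flow process at time `t` is measurable** with respect to any σ-algebra making `V s`,
`s ≤ t`, measurable (`im z > 0`): `Loewner.measurable_map_of_im_pos` for the family of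
(continuous) regularised driving paths up to time `t`. [cite: RohdeSchramm2005, §2.1] -/
theorem measurable_cmapProc {t : ℝ≥0} (hmeas : ∀ s, s ≤ t → Measurable fun ω ↦ V s ω)
    (hz : 0 < z.im) : Measurable fun ω ↦ cmapProc V z t ω := by
  have h1 : Measurable fun ω ↦ map (drivingUpTo V t ω) t z :=
    measurable_map_of_im_pos (W := fun ω ↦ drivingUpTo V t ω) (t := t)
      (fun ω ↦ continuous_drivingUpTo V t ω) (fun s _ ↦ measurable_drivingUpTo_apply hmeas s) hz
  have h2 : Measurable fun ω ↦ ((drivingUpTo V t ω t : ℝ) : ℂ) :=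
    measurable_ofReal.comp (measurable_drivingUpTo_apply hmeas t)
  have heq : (fun ω ↦ cmapProc V z t ω) = fun ω ↦ map (drivingUpTo V t ω) t z - drivingUpTo V t ω t := by
    funext ω; rfl
  rw [heq]
  exact h1.sub h2

/-- **The frozen-imaginary-part process at time `t` is measurable** (same hypotheses):
`{t < T_z} ` is measurable (`measurableSet_lt_swallowingTime_of_im_pos`) and so is the map.
[cite: RohdeSchramm2005, §2.1] -/
theorem measurable_imProc {t : ℝ≥0} (hmeas : ∀ s, s ≤ t → Measurable fun ω ↦ V s ω)
    (hz : 0 < z.im) : Measurable fun ω ↦ imProc V z t ω := by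
  classical
  have hE : MeasurableSet {ω | (t : WithTop ℝ≥0) < swallowingTime (drivingUpTo V t ω) z} :=
    measurableSet_lt_swallowingTime_of_im_pos (W := fun ω ↦ drivingUpTo V t ω) (t := t)
      (fun ω ↦ continuous_drivingUpTo V t ω) (fun s _ ↦ measurable_drivingUpTo_apply hmeas s) hz
  have h1 : Measurable fun ω ↦ (map (drivingUpTo V t ω) t z).im :=
    measurable_im.comp (measurable_map_of_im_pos (W := fun ω ↦ drivingUpTo V t ω) (t := t)
      (fun ω ↦ continuous_drivingUpTo V t ω) (fun s _ ↦ measurable_drivingUpTo_apply hmeas s) hz)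
  have heq : (fun ω ↦ imProc V z t ω) = fun ω ↦
      if (t : WithTop ℝ≥0) < swallowingTime (drivingUpTo V t ω) z then
        (map (drivingUpTo V t ω) t z).im else 0 := by
    funext ω; rfl
  rw [heq]
  exact Measurable.ite hE h1 measurable_const

/-- **The flow processes of an adapted driving process are adapted** (`im z > 0`).
[cite: RohdeSchramm2005, §2.1] -/
theorem adapted_re_cmapProc {𝓕 : Filtration ℝ≥0 mΩ} (hV : Adapted 𝓕 V) (hz : 0 < z.im) :
    Adapted 𝓕 fun t ω ↦ (cmapProc V z t ω).re := fun t ↦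
  measurable_re.comp (measurable_cmapProc (mΩ := 𝓕 t)
    (fun s hs ↦ (hV s).mono (𝓕.mono hs) le_rfl) hz)

/-- See `adapted_re_cmapProc`. [cite: RohdeSchramm2005, §2.1] -/
theorem adapted_imProc {𝓕 : Filtration ℝ≥0 mΩ} (hV : Adapted 𝓕 V) (hz : 0 < z.im) :
    Adapted 𝓕 (imProc V z) := fun t ↦
  measurable_imProc (mΩ := 𝓕 t) (fun s hs ↦ (hV s).mono (𝓕.mono hs) le_rfl) hz

/-! ### Progressive versions -/

variable (V z)

/-- Progressive version of `re z_t`: the dyadic regularisation of `re (cmapProc V z)`. [folklore] -/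
def xReg : ℝ≥0 → Ω → ℝ :=
  dyadicReg fun t ω ↦ (cmapProc V z t ω).re

/-- Progressive version of the frozen imaginary part: the dyadic regularisation of `imProc V z`.
[folklore] -/
def yReg : ℝ≥0 → Ω → ℝ :=
  dyadicReg (imProc V z)

variable {V z}

/-- `xReg` is progressively measurable for an adapted driver. [folklore] -/
theorem isStronglyProgressive_xReg {𝓕 : Filtration ℝ≥0 mΩ} (hV : Adapted 𝓕 V) (hz : 0 < z.im) :
    IsStronglyProgressive 𝓕 (xReg V z) :=
  isStronglyProgressive_dyadicReg (adapted_re_cmapProc hV hz)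

/-- `yReg` is progressively measurable for an adapted driver. [folklore] -/
theorem isStronglyProgressive_yReg {𝓕 : Filtration ℝ≥0 mΩ} (hV : Adapted 𝓕 V) (hz : 0 < z.im) :
    IsStronglyProgressive 𝓕 (yReg V z) :=
  isStronglyProgressive_dyadicReg (adapted_imProc hV hz)

/-- The dyadic regularisation agrees with the process at every time at which the path is
continuous from the left (the dyadic lower approximations increase to the time).
[folklore] -/
theorem dyadicReg_apply_of_continuousWithinAt {g : ℝ≥0 → Ω → ℝ} {ω : Ω} {t : ℝ≥0}
    (h : ContinuousWithinAt (g · ω) (Iic t) t) : dyadicReg g t ω = g t ω := by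
  have htend : Tendsto (fun n ↦ dyadicFloor n t) atTop (𝓝[Iic t] t) :=
    tendsto_nhdsWithin_iff.2 ⟨tendsto_dyadicFloor t, Eventually.of_forall fun n ↦ dyadicFloor_le n t⟩
  exact (h.tendsto.comp htend).limUnder_eq

/-- **On a continuous path `yReg` is the honest frozen imaginary part** at every time (the
latter has a continuous path). [folklore] -/
theorem yReg_eq_of_continuous {ω : Ω} (hc : Continuous fun s ↦ V s ω) (hz : 0 < z.im) (t : ℝ≥0) :
    yReg V z t ω = imFlowStop (fun s ↦ V s ω) z t := by
  have hpath : (fun t ↦ imProc V z t ω) = imFlowStop (fun s ↦ V s ω) z :=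
    funext (imProc_eq_of_continuous hc)
  have hcont : Continuous fun t ↦ imProc V z t ω := by
    rw [hpath]; exact continuous_imFlowStop hc hz
  rw [yReg, dyadicReg_apply_of_continuous hcont, imProc_eq_of_continuous hc]

/-- **On a continuous path `xReg` is the honest `re z_t` before the swallowing time** (where the
centred flow is continuous). [folklore] -/
theorem xReg_eq_of_continuous {ω : Ω} (hc : Continuous fun s ↦ V s ω) (hz : 0 < z.im) {t : ℝ≥0}
    (ht : (t : WithTop ℝ≥0) < swallowingTime (fun s ↦ V s ω) z) :
    xReg V z t ω = (centredMap (fun s ↦ V s ω) t z).re := by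
  have hpath : (fun t ↦ (cmapProc V z t ω).re) = fun t ↦ (centredMap (fun s ↦ V s ω) t z).re :=
    funext fun t ↦ by rw [cmapProc_eq_of_continuous hc]
  have hopen : IsOpen {r : ℝ≥0 | (r : WithTop ℝ≥0) < swallowingTime (fun s ↦ V s ω) z} :=
    isOpen_Iio.preimage WithTop.continuous_coe
  have hcontAt : ContinuousAt (fun t ↦ (cmapProc V z t ω).re) t := by
    rw [hpath]
    exact (continuous_re.continuousAt).comp
      ((continuousOn_centredMap hc (ne_driving_of_im_pos (W := fun s ↦ V s ω) hz 0)).continuousAt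
        (hopen.mem_nhds ht))
  rw [xReg, dyadicReg_apply_of_continuousWithinAt hcontAt.continuousWithinAt,
    cmapProc_eq_of_continuous hc]

end Proc

end Loewner

/-! ### The progressive version of `Z'` -/

namespace SLEKappaRho

/-- Progressive version of `Z' = W' + 2 ∫₀ J` (adapted, a.s. continuous): its dyadic
regularisation. [folklore] -/
def zReg (W' J : ℝ≥0 → (ℝ≥0 → ℝ) → ℝ) : ℝ≥0 → (ℝ≥0 → ℝ) → ℝ :=
  dyadicReg fun t ω ↦ W' t ω + 2 * timeIntegral J t ω

namespace RegularPair

variable {κ : ℝ≥0} {ρ : ℝ} {W W' J : ℝ≥0 → (ℝ≥0 → ℝ) → ℝ}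

/-- `Z' = W' + 2 ∫₀ J` is adapted for a regular version. [folklore] -/
theorem adapted_zPrime (h : RegularPair κ ρ W W' J) :
    Adapted brownianFiltration fun t ω ↦ W' t ω + 2 * timeIntegral J t ω := fun t ↦
  (h.adapted t).add ((adapted_timeIntegral h.progressive t).const_mul 2)

/-- `zReg` is progressively measurable for a regular version. [folklore] -/
theorem isStronglyProgressive_zReg (h : RegularPair κ ρ W W' J) :
    IsStronglyProgressive brownianFiltration (zReg W' J) :=
  isStronglyProgressive_dyadicReg h.adapted_zPrime

/-- `xReg W' z` is progressively measurable for a regular version (`im z > 0`). [folklore] -/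
theorem isStronglyProgressive_xReg (h : RegularPair κ ρ W W' J) {z : ℂ} (hz : 0 < z.im) :
    IsStronglyProgressive brownianFiltration (Loewner.xReg W' z) :=
  Loewner.isStronglyProgressive_xReg h.adapted hz

/-- `yReg W' z` is progressively measurable for a regular version (`im z > 0`). [folklore] -/
theorem isStronglyProgressive_yReg (h : RegularPair κ ρ W W' J) {z : ℂ} (hz : 0 < z.im) :
    IsStronglyProgressive brownianFiltration (Loewner.yReg W' z) :=
  Loewner.isStronglyProgressive_yReg h.adapted hz

end RegularPair

namespace GoodPath

variable {κ : ℝ≥0} {ρ : ℝ} {O W W' J : ℝ≥0 → (ℝ≥0 → ℝ) → ℝ} {ω : ℝ≥0 → ℝ} {z : ℂ}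

/-- On a good path `zReg` is `Z'` at every time. [folklore] -/
theorem zReg_eq (h : GoodPath κ ρ O W W' J ω) (t : ℝ≥0) :
    zReg W' J t ω = W' t ω + 2 * timeIntegral J t ω :=
  dyadicReg_apply_of_continuous h.continuous_zPrime t

/-- On a good path `yReg W' z` is the frozen imaginary part of the flow OF `W` at every time.
[folklore] -/
theorem yReg_eq (h : GoodPath κ ρ O W W' J ω) (hz : 0 < z.im) (t : ℝ≥0) :
    Loewner.yReg W' z t ω = Loewner.imFlowStop (fun s ↦ W s ω) z t := by
  rw [Loewner.yReg_eq_of_continuous h.continuous hz, h.path_eq]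

/-- On a good path `xReg W' z` is `re z_t` of the flow OF `W` before the swallowing time.
[folklore] -/
theorem xReg_eq (h : GoodPath κ ρ O W W' J ω) (hz : 0 < z.im) {t : ℝ≥0}
    (ht : (t : WithTop ℝ≥0) < Loewner.swallowingTime (fun s ↦ W s ω) z) :
    Loewner.xReg W' z t ω = (Loewner.centredMap (fun s ↦ W s ω) t z).re := by
  have ht' : (t : WithTop ℝ≥0) < Loewner.swallowingTime (fun s ↦ W' s ω) z := by rwa [h.path_eq]
  rw [Loewner.xReg_eq_of_continuous h.continuous hz ht', h.path_eq]

/-- On a good path `cmapProc W' z` is the centred flow OF `W` at every time. [folklore] -/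
theorem cmapProc_eq (h : GoodPath κ ρ O W W' J ω) (t : ℝ≥0) :
    Loewner.cmapProc W' z t ω = Loewner.centredMap (fun s ↦ W s ω) t z := by
  rw [Loewner.cmapProc_eq_of_continuous h.continuous, h.path_eq]

/-- On a good path `imProc W' z` is the frozen imaginary part of the flow OF `W` at every time.
[folklore] -/
theorem imProc_eq (h : GoodPath κ ρ O W W' J ω) (t : ℝ≥0) :
    Loewner.imProc W' z t ω = Loewner.imFlowStop (fun s ↦ W s ω) z t := by
  rw [Loewner.imProc_eq_of_continuous h.continuous, h.path_eq]

end GoodPath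

end SLEKappaRho

end Literature.Probability.RandomPlanarGeometry
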